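import Literature.AlgebraicGeometry.HodgeTheory.HigherSigmaOfIso
import Mathlib.Algebra.Homology.DerivedCategory.ShortExact
import Mathlib.Algebra.Homology.HomologicalComplexAbelian
import HarnessLib

/-!
# The Atiyah class of a cochain complex of `𝒪_X`-modules, on real carriers

PROMOTED LITERATURE COPY (librarian protocol (b); DEFREQ-CoherentISemiregular, cell pub-hsemireg) of the generic, conjecture-free
`Summits/Ventures/HSemireg/ComplexAtiyahClass.lean` — namespace now `Literature.AlgebraicGeometry.HodgeTheory`, names kept; cell words (seats, ventures) = provenance.

Cell `pub-hsemireg` (run/shared/lean/pub/pub-hsemireg/), Lean side (p3), lead rulings R-53(a)/R-54(c)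
(«K2-MIN» kernel assets; CAP: one file per seat; sibling files `HigherSigmaOfIso.lean` (gs-g4) and the internal
Hom complex (t-7)). HONEST FRAMING: infrastructure only. This file is NOT a
door, NOT a named fact, NOT a statement about any variety, and NOT a «K2 result» of the cell: the cell's
class-(C) objects (perfect complexes) still have no tree door (LEAN-SIDE.md §2b, D4). It is the complex-level
analogue of `HodgeTheory/AtiyahClass.lean` (pieces (b)+(d) of the cell's costed blueprint
general-structure/G4-SUMMARY.md, gs-g4 gen 14, at `q = 1`), for a later session that may build a
semiregularity map for strictly perfect complexes.

## Contents (everything proved; no named facts; Mathlib + tree only)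

For a commutative ring `S`, an `S`-scheme `X : Over (Spec S)` and cochain complexes `E•, F•` of `𝒪_X`-modules:

* (used, from `HigherSigmaOfIso.lean`: the additive functor `twistFunctor Y G : E ↦ 𝓗om(E^∨, G)`, the tree's
  model of `E ⊗ G` — `AtiyahClass.lean`: `twistCotangent E = 𝓗om(E^∨, Ω¹)` —, on maps the tree's `twistMap`);
* `jetFunctor X : X.Modules ⥤ X.Modules`, `E ↦ P¹(E)` (Atiyah's jet module `jetModule`), on maps the tree's
  `jetMap` — additive (`jetMap_id`, `jetMap_comp`, `jetMap_add`; Atiyah 1957 Prop. 6); the two maps of the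
  Atiyah sequence as natural transformations `jetιNatTrans : twistFunctor X Ω¹ ⟶ jetFunctor X`,
  `jetπNatTrans : jetFunctor X ⟶ 𝟭` (`jetι_naturality`, `jetπ_naturality`);
* `twistComplex G E• = E• ⊗ G` and `jetComplex E• = P¹(E•)` (the functors applied termwise; differentials
  `d ⊗ 1`, `P¹(d)`), the **Atiyah sequence of a complex** `jetShortComplexC E• : 0 → E• ⊗ Ω¹ → P¹(E•) → E• → 0`
  and `jetShortComplexC_shortExact` (degreewise = the module statement `jetShortComplex_shortExact`);
* **`atiyahClassC E• : Q E• ⟶ (Q (E• ⊗ Ω¹))⟦1⟧`** in the derived category `DerivedCategory X.Modules` (any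
  `HasDerivedCategory` instance): the connecting morphism of the distinguished triangle of the Atiyah sequence
  (Mathlib `DerivedCategory.triangleOfSESδ`; `atiyahTriangle_distinguished`) — for `E•` a bounded complex of
  finite locally free modules this is the Atiyah class `At(E•) ∈ Ext¹(E•, E• ⊗ Ω¹)` of the perfect complex
  `E•` (cf. Buchweitz–Flenner 2003 §3, where `At` of a complex is defined through Atiyah extensions; no comparison
  with their construction is claimed here beyond the single-module case `atiyahClassC_single`);
* `jetShortComplexC.map f` and **`atiyahClassC_naturality`**: `At(E•) ≫ (f ⊗ 1)⟦1⟧' = Q f ≫ At(F•)` for every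
  chain map `f : E• → F•` (Mathlib `triangleOfSESδ_naturality`);
* **`atiyahClassC_single`** (correctness anchor): for a module `E`, under the identification
  `τ₁ : (E[0]) ⊗ Ω¹ → (E ⊗ Ω¹)[0]` (`twistComplexSingleHom`, an identity in degree `0`),
  `At(E[0]) ≫ (Q τ₁)⟦1⟧' = (atiyahClass E).hom` — the complex-level class of the single complex `E[0]` IS the
  image in the derived category of the tree's module Atiyah class (Mathlib `ShortExact.extClass_hom`,
  `singleδ`; the morphism of Atiyah sequences `jetShortComplexCSingleHom`).

* **twisted steps and powers** (section `Power`, on the termwise twisted Atiyah sequences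
  `twistJetComplexShortComplex` of `HigherSigmaOfIso.lean`): `complexAtiyahStep X j K : Q (K ⊗ Ωʲ) ⟶ (Q (K ⊗ Ωʲ⁺¹))⟦1⟧`,
  its naturality in `K` (`complexAtiyahStep_naturality`), the powers
  `complexAtiyahPower X K q : (K ⊗ Ω⁰) ⟶ (K ⊗ Ω^q)⟦q⟧` (`ShiftedHom.comp`; `At^0 = 𝟙`, `At^{q+1} = At^q · At_q`),
  `mulAtiyahPower` (`x ↦ x · At^q`), the adapter `toTwistHodgeZeroC : K• ⟶ K• ⊗ Ω⁰` (termwise the tree's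
  `toTwistHodgeZero`, natural by `toTwistHodgeZero_naturality`) and `extMulAtiyahPower`
  (`x ∈ Ext²(K•, K•) ↦ (x · ι•) · At^q : K• ⟶ (K• ⊗ Ω^q)[q + 2]`, the argument of a future `σ_q`, as in the module
  `SemiregularityHigherSigma.sigmaHigher`).

## What is NOT here

The identification of `atiyahClassC E•` (untwisted, `Ω¹`, `jetι`) with `complexAtiyahStep X 0 E•` (twisted,
`E ⊗ Ω⁰ → E ⊗ ⋀¹Ω¹`) along the module-level comparison `jetToTwistJet` / `atiyahClass_comp_hodgeSheafOneIso_inv`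
of `SemiregularityHigherSigma.lean`; any trace `Ext^{q+2}(E•, E• ⊗ Ω^q) → H^{q+2}(X, Ω^q)` for complexes (needs the internal Hom
complex `𝓗om•(E•, –)` and its descent to the derived category); anything about semiregularity.

## References

* M. F. Atiyah, Complex analytic connections in fibre bundles, Trans. AMS 85 (1957), §4 Prop. 6–7
  (functoriality of `D(E)` and naturality of `b(E)`). [Atiyah1957]
* R.-O. Buchweitz, H. Flenner, A semiregularity map for modules and applications to deformations, Compositio
  Math. 137 (2003), §3 (the Atiyah class of a complex / of a module via the Atiyah extension). [BuchweitzFlenner2003]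
* The Stacks project, Tag 01CM (internal Hom of sheaves of modules). [StacksProject]
-/

noncomputable section

open CategoryTheory CategoryTheory.Limits CategoryTheory.Abelian AlgebraicGeometry Opposite
  Literature.AlgebraicGeometry.Motives Literature.AlgebraicGeometry.HodgeTheory Literature.AlgebraicGeometry.Modules

universe w' u

namespace Literature.AlgebraicGeometry.HodgeTheory

/-! ### `E ↦ P¹(E)` as an additive functor; `jetι`, `jetπ` as natural transformations -/

section Jet

variable {S : Type u} [CommRing S] {X : Over (Spec (CommRingCat.of S))} {E₁ E₂ E₃ : X.left.Modules}

/-- `P¹(𝟙) = 𝟙`. [cite: Atiyah1957, §4 Prop. 6] -/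
@[simp]
lemma jetMap_id : jetMap (𝟙 E₁) = 𝟙 (jetModule E₁) := by
  refine Scheme.Modules.hom_ext _ _ fun U => AddCommGrpCat.ext fun (p : JetSections E₁ U) => ?_
  refine JetSections.ext rfl ?_
  change ((twistFunctor X.left (cotangentSheaf X)).map (𝟙 E₁)).app U p.snd = p.snd
  rw [(twistFunctor X.left (cotangentSheaf X)).map_id]
  rfl

/-- `P¹(g ≫ g') = P¹(g) ≫ P¹(g')`. [cite: Atiyah1957, §4 Prop. 6] -/
lemma jetMap_comp (g : E₁ ⟶ E₂) (g' : E₂ ⟶ E₃) : jetMap (g ≫ g') = jetMap g ≫ jetMap g' := by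
  refine Scheme.Modules.hom_ext _ _ fun U => AddCommGrpCat.ext fun (p : JetSections E₁ U) => ?_
  refine JetSections.ext rfl ?_
  change ((twistFunctor X.left (cotangentSheaf X)).map (g ≫ g')).app U p.snd =
    ((twistFunctor X.left (cotangentSheaf X)).map g').app U
      (((twistFunctor X.left (cotangentSheaf X)).map g).app U p.snd)
  rw [(twistFunctor X.left (cotangentSheaf X)).map_comp, Scheme.Modules.Hom.comp_app]
  rfl

/-- `P¹(g + g') = P¹(g) + P¹(g')`. [cite: Atiyah1957, §4 Prop. 6] -/
lemma jetMap_add (g g' : E₁ ⟶ E₂) : jetMap (g + g') = jetMap g + jetMap g' := by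
  refine Scheme.Modules.hom_ext _ _ fun U => AddCommGrpCat.ext fun (p : JetSections E₁ U) => ?_
  refine JetSections.ext ?_ ?_
  · change (g + g').app U p.fst = g.app U p.fst + g'.app U p.fst
    rw [Scheme.Modules.Hom.add_app]
    rfl
  · change ((twistFunctor X.left (cotangentSheaf X)).map (g + g')).app U p.snd =
      ((twistFunctor X.left (cotangentSheaf X)).map g).app U p.snd +
        ((twistFunctor X.left (cotangentSheaf X)).map g').app U p.snd
    rw [(twistFunctor X.left (cotangentSheaf X)).map_add, Scheme.Modules.Hom.add_app]
    rfl

variable (X) in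
/-- **The jet functor** `E ↦ P¹(E)`, `g ↦ P¹(g)` (Atiyah 1957, Prop. 6: `D` is functorial).
[cite: Atiyah1957, §4 Prop. 6] -/
@[simps obj map]
def jetFunctor : X.left.Modules ⥤ X.left.Modules where
  obj E := jetModule E
  map g := jetMap g
  map_id _ := jetMap_id
  map_comp g g' := jetMap_comp g g'

/-- `E ↦ P¹(E)` is additive: `P¹(g + g') = P¹(g) + P¹(g')`. [cite: Atiyah1957, §4 Prop. 6] -/
instance jetFunctor_additive : (jetFunctor X).Additive where
  map_add := jetMap_add _ _

/-- Naturality of `jetι`: `(g ⊗ 1) ≫ ι_{E₂} = ι_{E₁} ≫ P¹(g)`. [cite: Atiyah1957, §4 Prop. 6] -/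
@[reassoc]
lemma jetι_naturality (g : E₁ ⟶ E₂) :
    twistMap g (cotangentSheaf X) ≫ jetι E₂ = jetι E₁ ≫ jetMap g :=
  Scheme.Modules.hom_ext _ _ fun U => AddCommGrpCat.ext
    fun (_ : (dual E₁).over U ⟶ (cotangentSheaf X).over U) =>
      JetSections.ext ((g.app U).hom.map_zero).symm rfl

/-- Naturality of `jetπ`: `P¹(g) ≫ π_{E₂} = π_{E₁} ≫ g`. [cite: Atiyah1957, §4 Prop. 6] -/
@[reassoc]
lemma jetπ_naturality (g : E₁ ⟶ E₂) : jetMap g ≫ jetπ E₂ = jetπ E₁ ≫ g :=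
  Scheme.Modules.hom_ext _ _ fun U => AddCommGrpCat.ext fun (_ : JetSections E₁ U) => rfl

variable (X) in
/-- `jetι` as a natural transformation `(– ⊗ Ω¹) ⟶ P¹`. [cite: Atiyah1957, §4] -/
@[simps]
def jetιNatTrans : twistFunctor X.left (cotangentSheaf X) ⟶ jetFunctor X where
  app E := jetι E
  naturality _ _ g := jetι_naturality g

variable (X) in
/-- `jetπ` as a natural transformation `P¹ ⟶ 𝟭`. [cite: Atiyah1957, §4] -/
@[simps]
def jetπNatTrans : jetFunctor X ⟶ 𝟭 X.left.Modules where
  app E := jetπ E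
  naturality _ _ g := jetπ_naturality g

end Jet

/-! ### The termwise Atiyah sequence of a cochain complex and its class in the derived category -/

section Complex

variable {S : Type u} [CommRing S] {X : Over (Spec (CommRingCat.of S))}

/-- `E• ⊗ G`: the twist functor applied termwise. [folklore] -/
abbrev twistComplex (G : X.left.Modules) (E : CochainComplex X.left.Modules ℤ) :
    CochainComplex X.left.Modules ℤ :=
  ((twistFunctor X.left G).mapHomologicalComplex (ComplexShape.up ℤ)).obj E

/-- `P¹(E•)`: the jet functor applied termwise (differentials `P¹(d)`). [folklore] -/
abbrev jetComplex (E : CochainComplex X.left.Modules ℤ) : CochainComplex X.left.Modules ℤ :=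
  ((jetFunctor X).mapHomologicalComplex (ComplexShape.up ℤ)).obj E

variable (E F : CochainComplex X.left.Modules ℤ)

/-- **The Atiyah sequence of a complex** `0 → E• ⊗ Ω¹_{X/S} → P¹(E•) → E• → 0` (termwise the module
sequence; the differentials of the two left terms are `d ⊗ 1` and `P¹(d)`). [cite: BuchweitzFlenner2003, §3 (Atiyah class of a complex)] -/
def jetShortComplexC : ShortComplex (CochainComplex X.left.Modules ℤ) where
  X₁ := twistComplex (cotangentSheaf X) E
  X₂ := jetComplex E
  X₃ := E
  f := { f := fun i => jetι (E.X i)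
         comm' := fun i j _ => (jetι_naturality (E.d i j)).symm }
  g := { f := fun i => jetπ (E.X i)
         comm' := fun i j _ => (jetπ_naturality (E.d i j)).symm }
  zero := HomologicalComplex.hom_ext _ _ fun i => jetι_comp_jetπ (E.X i)

/-- Components of the Atiyah sequence of a complex. [cite: Atiyah1957, §4 Prop. 6–7] -/
@[simp] lemma jetShortComplexC_f_f (i : ℤ) : (jetShortComplexC E).f.f i = jetι (E.X i) := rfl

/-- Components of the Atiyah sequence of a complex. [cite: Atiyah1957, §4 Prop. 6–7] -/
@[simp] lemma jetShortComplexC_g_f (i : ℤ) : (jetShortComplexC E).g.f i = jetπ (E.X i) := rfl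

/-- **The Atiyah sequence of a complex is short exact** (degreewise it is the module statement
`jetShortComplex_shortExact`). [cite: BuchweitzFlenner2003, §3] -/
theorem jetShortComplexC_shortExact : (jetShortComplexC E).ShortExact :=
  HomologicalComplex.shortExact_of_degreewise_shortExact _ fun i => jetShortComplex_shortExact (E.X i)

variable [HasDerivedCategory.{w'} X.left.Modules]

/-- **The Atiyah class of a cochain complex of `𝒪_X`-modules** `At(E•) : E• → (E• ⊗ Ω¹_{X/S})[1]` in the
derived category `D(𝒪_X-Mod)`: the connecting morphism of the distinguished triangle of the termwise Atiyah
sequence (Mathlib `DerivedCategory.triangleOfSESδ`). For `E•` a bounded complex of finite locally free modules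
this is the Atiyah class of the perfect complex `E•` (Illusie; Buchweitz–Flenner §3; Huybrechts–Thomas).
[cite: BuchweitzFlenner2003, §3 (Atiyah class)] -/
def atiyahClassC :
    DerivedCategory.Q.obj E ⟶ (DerivedCategory.Q.obj (twistComplex (cotangentSheaf X) E))⟦(1 : ℤ)⟧ :=
  DerivedCategory.triangleOfSESδ (jetShortComplexC_shortExact E)

/-- The Atiyah triangle `E• ⊗ Ω¹ → P¹(E•) → E• → (E• ⊗ Ω¹)[1]` is distinguished. [cite: BuchweitzFlenner2003, Def. 3.4 (Atiyah class of a complex and its powers)] -/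
theorem atiyahTriangle_distinguished :
    DerivedCategory.triangleOfSES (jetShortComplexC_shortExact E) ∈
      Pretriangulated.distinguishedTriangles :=
  DerivedCategory.triangleOfSES_distinguished _

variable {E F}

/-- A chain map `f : E• → F•` induces a morphism of Atiyah sequences `(f ⊗ 1, P¹(f), f)`. [folklore] -/
@[simps]
def jetShortComplexC.map (f : E ⟶ F) : jetShortComplexC E ⟶ jetShortComplexC F where
  τ₁ := ((twistFunctor X.left (cotangentSheaf X)).mapHomologicalComplex (ComplexShape.up ℤ)).map f
  τ₂ := ((jetFunctor X).mapHomologicalComplex (ComplexShape.up ℤ)).map f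
  τ₃ := f
  comm₁₂ := HomologicalComplex.hom_ext _ _ fun i => jetι_naturality (f.f i)
  comm₂₃ := HomologicalComplex.hom_ext _ _ fun i => jetπ_naturality (f.f i)

/-- **Naturality of the Atiyah class of complexes**: for a chain map `f : E• → F•`,
`At(E•) ≫ (f ⊗ 1)[1] = f ≫ At(F•)` in the derived category. [cite: BuchweitzFlenner2003, §3] -/
theorem atiyahClassC_naturality (f : E ⟶ F) :
    atiyahClassC E ≫ (DerivedCategory.Q.map
        (((twistFunctor X.left (cotangentSheaf X)).mapHomologicalComplex (ComplexShape.up ℤ)).map f))⟦(1 : ℤ)⟧' =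
      DerivedCategory.Q.map f ≫ atiyahClassC F :=
  DerivedCategory.triangleOfSESδ_naturality (jetShortComplexC_shortExact E) (jetShortComplexC_shortExact F)
    (jetShortComplexC.map f)

end Complex

/-! ### Comparison with the module Atiyah class: the single complex `E[0]` -/

open HomologicalComplex in
/-- In degree `0`, the twist functor applied to `E[0]` maps to `(E ⊗ Ω¹)[0]` by `F(E[0]⁰ ≅ E)`. [folklore] -/
def twistComplexSingleHom {S : Type u} [CommRing S] {X : Over (Spec (CommRingCat.of S))}
    (E : X.left.Modules) :
    twistComplex (cotangentSheaf X) ((single X.left.Modules (ComplexShape.up ℤ) 0).obj E) ⟶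
      (single X.left.Modules (ComplexShape.up ℤ) 0).obj (twistCotangent E) :=
  mkHomToSingle ((twistFunctor X.left (cotangentSheaf X)).map (singleObjXSelf (ComplexShape.up ℤ) 0 E).hom)
    (fun i _ => by
      rw [Functor.mapHomologicalComplex_obj_d, single_obj_d, (twistFunctor X.left (cotangentSheaf X)).map_zero]
      exact zero_comp)

open HomologicalComplex in
/-- In degree `0`, the jet functor applied to `E[0]` maps to `P¹(E)[0]` by `P¹(E[0]⁰ ≅ E)`. [folklore] -/
def jetComplexSingleHom {S : Type u} [CommRing S] {X : Over (Spec (CommRingCat.of S))}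
    (E : X.left.Modules) :
    jetComplex ((single X.left.Modules (ComplexShape.up ℤ) 0).obj E) ⟶
      (single X.left.Modules (ComplexShape.up ℤ) 0).obj (jetModule E) :=
  mkHomToSingle ((jetFunctor X).map (singleObjXSelf (ComplexShape.up ℤ) 0 E).hom) (fun i _ => by
    rw [Functor.mapHomologicalComplex_obj_d, single_obj_d, (jetFunctor X).map_zero]
    exact zero_comp)

open HomologicalComplex in
/-- The Atiyah sequence of the single complex `E[0]` maps to the single complex of the Atiyah sequence of
`E` (in degree `0`: the identifications `F(E[0]⁰) ≅ F(E)`; zero elsewhere). [folklore] -/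
def jetShortComplexCSingleHom {S : Type u} [CommRing S] {X : Over (Spec (CommRingCat.of S))}
    (E : X.left.Modules) :
    jetShortComplexC ((single X.left.Modules (ComplexShape.up ℤ) 0).obj E) ⟶
      (jetShortComplex E).map (single X.left.Modules (ComplexShape.up ℤ) 0) where
  τ₁ := twistComplexSingleHom E
  τ₂ := jetComplexSingleHom E
  τ₃ := 𝟙 _
  comm₁₂ := to_single_hom_ext (by
    dsimp only [jetShortComplex]
    simp only [twistComplexSingleHom, jetComplexSingleHom, HomologicalComplex.comp_f, ShortComplex.map_f,
      mkHomToSingle_f, jetShortComplexC_f_f, single_map_f_self, twistFunctor_map, jetFunctor_map]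
    rfl)
  comm₂₃ := to_single_hom_ext (by
    dsimp only [jetShortComplex]
    simp only [jetComplexSingleHom, HomologicalComplex.comp_f, ShortComplex.map_g, mkHomToSingle_f,
      jetShortComplexC_g_f, single_map_f_self, jetFunctor_map, HomologicalComplex.id_f]
    rfl)

/-- **`At(E[0])` is the module Atiyah class `At(E)`**: under the identification
`(E ⊗ Ω¹)[0] ≅ E[0] ⊗ Ω¹` the complex-level class of the single complex `E[0]` is the image
`(atiyahClass E).hom` of the tree's module class in the derived category (Mathlib `extClass_hom`).
[cite: BuchweitzFlenner2003, §3] -/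
theorem atiyahClassC_single {S : Type u} [CommRing S] {X : Over (Spec (CommRingCat.of S))}
    [HasDerivedCategory.{w'} X.left.Modules] (E : X.left.Modules) :
    atiyahClassC ((HomologicalComplex.single X.left.Modules (ComplexShape.up ℤ) 0).obj E) ≫
      (DerivedCategory.Q.map (jetShortComplexCSingleHom E).τ₁)⟦(1 : ℤ)⟧' =
    (atiyahClass E).hom := by
  refine (DerivedCategory.triangleOfSESδ_naturality (jetShortComplexC_shortExact _)
    ((jetShortComplex_shortExact E).map_of_exact
      (HomologicalComplex.single X.left.Modules (ComplexShape.up ℤ) 0)) (jetShortComplexCSingleHom E)).trans ?_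
  change DerivedCategory.Q.map (𝟙 _) ≫ _ = (jetShortComplex_shortExact E).extClass.hom
  rw [ShortComplex.ShortExact.extClass_hom, CategoryTheory.Functor.map_id, Category.id_comp]
  simp only [ShortComplex.ShortExact.singleδ, Functor.mapIso_hom, Functor.mapIso_inv, SingleFunctors.evaluation_map,
    DerivedCategory.singleFunctorsPostcompQIso_hom_hom, DerivedCategory.singleFunctorsPostcompQIso_inv_hom,
    NatTrans.id_app]
  erw [CategoryTheory.Functor.map_id, Category.comp_id, Category.id_comp]

/-! ### The twisted Atiyah steps and the powers `At(E•)^q` (on the tree's twisted jet sequences of complexes) -/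

section Power

variable {S : Type u} [CommRing S] (X : Over (Spec (CommRingCat.of S)))
  [HasDerivedCategory.{w'} X.left.Modules]

/-- `K• ⊗ Ωʲ` (the twist functor by `Ωʲ_{X/S}` applied termwise). [folklore] -/
abbrev twistHodgeComplex (j : ℕ) (K : CochainComplex X.left.Modules ℤ) : CochainComplex X.left.Modules ℤ :=
  ((twistHodgeFunctor X j).mapHomologicalComplex (ComplexShape.up ℤ)).obj K

/-- **The `j`-th twisted Atiyah step of a complex** `At_j(K•) : K• ⊗ Ωʲ → (K• ⊗ Ωʲ⁺¹)[1]`: the connecting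
morphism of the distinguished triangle of the termwise twisted Atiyah sequence
`0 → K ⊗ Ωʲ⁺¹ → Pʲ(K) → K ⊗ Ωʲ → 0` (Mathlib `DerivedCategory.triangleOfSESδ`). [cite: BuchweitzFlenner2003, §3] -/
def complexAtiyahStep (j : ℕ) (K : CochainComplex X.left.Modules ℤ) :
    ShiftedHom (DerivedCategory.Q.obj (twistHodgeComplex X j K))
      (DerivedCategory.Q.obj (twistHodgeComplex X (j + 1) K)) (1 : ℤ) :=
  DerivedCategory.triangleOfSESδ (twistJetComplexShortComplex_shortExact (X := X) j K)

/-- A chain map induces a morphism of termwise twisted Atiyah sequences. [folklore] -/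
def twistJetComplexShortComplexMap (j : ℕ) {K L : CochainComplex X.left.Modules ℤ} (f : K ⟶ L) :
    twistJetComplexShortComplex X j K ⟶ twistJetComplexShortComplex X j L where
  τ₁ := ((twistHodgeFunctor X (j + 1)).mapHomologicalComplex _).map f
  τ₂ := ((twistJetFunctor X j).mapHomologicalComplex _).map f
  τ₃ := ((twistHodgeFunctor X j).mapHomologicalComplex _).map f
  comm₁₂ := ((NatTrans.mapHomologicalComplex (twistJetιNatTrans X j) (ComplexShape.up ℤ)).naturality f).symm
  comm₂₃ := ((NatTrans.mapHomologicalComplex (twistJetπNatTrans X j) (ComplexShape.up ℤ)).naturality f).symm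

/-- **Naturality of the twisted Atiyah step** in the complex: `At_j(K) ≫ (f ⊗ 1)⟦1⟧ = (f ⊗ 1) ≫ At_j(L)`.
[cite: BuchweitzFlenner2003, §3] -/
theorem complexAtiyahStep_naturality (j : ℕ) {K L : CochainComplex X.left.Modules ℤ} (f : K ⟶ L) :
    complexAtiyahStep X j K ≫
        (DerivedCategory.Q.map (((twistHodgeFunctor X (j + 1)).mapHomologicalComplex _).map f))⟦(1 : ℤ)⟧' =
      DerivedCategory.Q.map (((twistHodgeFunctor X j).mapHomologicalComplex _).map f) ≫ complexAtiyahStep X j L :=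
  DerivedCategory.triangleOfSESδ_naturality _ _ (twistJetComplexShortComplexMap X j f)

/-- **The powers `At(K•)^q : K• ⊗ Ω⁰ → (K• ⊗ Ω^q)[q]`** as degree-`q` shifted morphisms in the derived category:
`At^0 = 𝟙`, `At^{q+1} = At^q` then `At_q` (Mathlib `ShiftedHom.comp`, `ShiftedHom.mk₀`).
[cite: BuchweitzFlenner2003, Def. 4.1 (powers of the Atiyah class)] -/
def complexAtiyahPower (K : CochainComplex X.left.Modules ℤ) :
    (q : ℕ) → ShiftedHom (DerivedCategory.Q.obj (twistHodgeComplex X 0 K))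
      (DerivedCategory.Q.obj (twistHodgeComplex X q K)) (q : ℤ)
  | 0 => ShiftedHom.mk₀ (0 : ℤ) rfl (𝟙 _)
  | q + 1 => (complexAtiyahPower K q).comp (complexAtiyahStep X q K) (by push_cast; ring)

/-- `At^0 = 𝟙`. [cite: BuchweitzFlenner2003, Def. 3.4 (Atiyah class of a complex and its powers)] -/
lemma complexAtiyahPower_zero (K : CochainComplex X.left.Modules ℤ) :
    complexAtiyahPower X K 0 = ShiftedHom.mk₀ (0 : ℤ) rfl (𝟙 _) := rfl

/-- `At^{q+1} = At^q · At_q`. [cite: BuchweitzFlenner2003, Def. 3.4 (Atiyah class of a complex and its powers)] -/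
lemma complexAtiyahPower_succ (K : CochainComplex X.left.Modules ℤ) (q : ℕ) :
    complexAtiyahPower X K (q + 1) =
      (complexAtiyahPower X K q).comp (complexAtiyahStep X q K) (by push_cast; ring) := rfl

/-- The composite `x · At(K•)^q ∈ Ext^{q+2}` for `x : K• ⊗ Ω⁰ → (K• ⊗ Ω⁰)[2]` — the argument of `σ_q`. [folklore] -/
def mulAtiyahPower (K : CochainComplex X.left.Modules ℤ) (q : ℕ)
    (x : ShiftedHom (DerivedCategory.Q.obj (twistHodgeComplex X 0 K))
      (DerivedCategory.Q.obj (twistHodgeComplex X 0 K)) (2 : ℤ)) :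
    ShiftedHom (DerivedCategory.Q.obj (twistHodgeComplex X 0 K))
      (DerivedCategory.Q.obj (twistHodgeComplex X q K)) ((q : ℤ) + 2) :=
  x.comp (complexAtiyahPower X K q) (by ring)

/-- `ι : E ⟶ E ⊗ Ω⁰` (biduality, then `𝒪_X ≅ Ω⁰`; the tree's `toTwistHodgeZero`) as a natural transformation
`𝟭 ⟶ twistHodgeFunctor X 0` (naturality: `toTwistHodgeZero_naturality`, HigherSigmaOfIso.lean).
[cite: Hartshorne1977, II Ex. 5.1 (a)] -/
@[simps]
def toTwistHodgeZeroNatTrans : 𝟭 X.left.Modules ⟶ twistHodgeFunctor X 0 where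
  app E := toTwistHodgeZero E
  naturality _ _ g := (toTwistHodgeZero_naturality g).symm

/-- `ι• : E• ⟶ E• ⊗ Ω⁰`, termwise `toTwistHodgeZero`. [folklore] -/
def toTwistHodgeZeroC (K : CochainComplex X.left.Modules ℤ) : K ⟶ twistHodgeComplex X 0 K :=
  (Functor.mapHomologicalComplexIdIso X.left.Modules (ComplexShape.up ℤ)).inv.app K ≫
    (NatTrans.mapHomologicalComplex (toTwistHodgeZeroNatTrans X) (ComplexShape.up ℤ)).app K

/-- **The argument of `σ_q` for a complex**: `x ∈ Ext²(K•, K•)` (a degree-`2` shifted endomorphism of `Q K•`)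
`↦ (x · ι•) · At(K•)^q : K• ⟶ (K• ⊗ Ω^q)[q + 2]` — the complex-level analogue of the module composite inside
`SemiregularityHigherSigma.sigmaHigher`. [cite: BuchweitzFlenner2003, Def. 4.1] -/
def extMulAtiyahPower (K : CochainComplex X.left.Modules ℤ) (q : ℕ)
    (x : ShiftedHom (DerivedCategory.Q.obj K) (DerivedCategory.Q.obj K) (2 : ℤ)) :
    ShiftedHom (DerivedCategory.Q.obj K) (DerivedCategory.Q.obj (twistHodgeComplex X q K)) ((q : ℤ) + 2) :=
  (x.comp (ShiftedHom.mk₀ (0 : ℤ) rfl (DerivedCategory.Q.map (toTwistHodgeZeroC X K))) (zero_add 2)).comp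
    (complexAtiyahPower X K q) (by ring)

end Power

end Literature.AlgebraicGeometry.HodgeTheory

end
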